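import Literature.RepresentationTheory.CompactGroups.WeylIntegrationCoordinates
import Mathlib.LinearAlgebra.Vandermonde
import Mathlib.MeasureTheory.Integral.Pi
import Mathlib.Analysis.SpecialFunctions.Integrals.Basic
import Mathlib.MeasureTheory.Measure.Lebesgue.Basic

/-!
# Weyl's integral formula for `U(n)`, file 7: the normalising constant
# `∫_{(−π,π]ⁿ} Π_{j≺k} |e^{iθ_j} − e^{iθ_k}|² dθ = (2π)ⁿ · n!`

statement-level skeleton of published theorems with citation tags; proofs where landed; nothing here is a claim
about the Yang–Mills mass gap

Mega-formalization `lit-balaban` (HOME `run/shared/lean/pub/lit-balaban/`), unit `lit-balaban-p28` gen 15 (Phase-2 proof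
seat, free-target protocol G.5-34(d)): FILE 7 of the discharge of the tree's named fact
`Literature.RepresentationTheory.CompactGroups.weylIntegralFormula_unitary` ([BtD] IV (1.11), `G = U(n)`).  The factor
`1/|W| = 1/n!` of (1.11) is forced by `f ≡ 1`: the normalised invariant integral of `det(E − Ad_{G/T}(t⁻¹)) =
Π_{μ≠ν}|t_μ − t_ν| = |Δ(t)|²` over the torus `Δ(n)` is `|W| = n!`.  Here this is computed in angle coordinates
(file 6 turns Haar measure on `Δ(n)` into `(2π)^{−n} dθ` on `(−π, π]ⁿ`): the Vandermonde determinant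
`Δ(t) = det(t_a^{ν(b)}) = Π_{j≺k}(t_k − t_j)` (Mathlib `Matrix.det_vandermonde`), its Leibniz expansion
`Δ = Σ_σ sgn σ · Π_b t_b^{ν(σ⁻¹b)}` (Mathlib `Matrix.det_apply'`), hence
`|Δ|² = Σ_{σ,τ} sgn σ sgn τ Π_b e^{i(ν(σ⁻¹b) − ν(τ⁻¹b))θ_b}`, and the orthogonality of characters
`∫_{−π}^{π} e^{imθ} dθ = 2π δ_{m0}` (only `σ = τ` survives: `n!` terms, each `(2π)ⁿ`).
* §1 `∫_{(−π,π]} e^{imx} dx = 2π·[m = 0]` and its `n`-fold product form;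
* §2 the Vandermonde product `Π_{j≺k}(t_k − t_j)` as a determinant and its expansion in characters;
* §3 **`lintegral_angleCube_prod_norm_exp_sub_sq`**: `∫_{(−π,π]ⁿ} Π_{j≺k}|e^{iθ_j} − e^{iθ_k}|² dθ = (2π)ⁿ n!`.

0 named facts, 0 sorry.

## References
* Th. Bröcker, T. tom Dieck, *Representations of Compact Lie Groups*, GTM 98 (1985), Ch. IV (1.11) p. 163 (the factor
  `|W|`), (3.2) p. 170 (`|W(U(n))| = n!`) (held: `book:brockernd-representations-compact-lie-groups`, p0153, p0161).
  [BrockerTomDieck1985]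
-/

noncomputable section

open Complex Matrix MeasureTheory Set Real Equiv Finset
open scoped ComplexConjugate ENNReal

namespace Literature.RepresentationTheory.CompactGroups.WeylIntegration

variable {n : Type*} [Fintype n] [DecidableEq n]

/-! ## §1 Orthogonality of characters on `(−π, π]` -/

/-- **`∫_{(−π,π]} e^{imx} dx = 2π` if `m = 0`, `= 0` otherwise** (`m ∈ ℤ`). [cite: BrockerTomDieck1985, IV (1.11) p0153] -/
theorem integral_Ioc_cexp_int_mul (m : ℤ) :
    ∫ x in Set.Ioc (-π) π, cexp (m * x * I) = if m = 0 then (2 * π : ℂ) else 0 := by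
  split_ifs with hm
  · subst hm
    simp only [Int.cast_zero, zero_mul, Complex.exp_zero, setIntegral_const, measureReal_def, Real.volume_Ioc,
      sub_neg_eq_add]
    rw [ENNReal.toReal_ofReal (by positivity)]
    simp [two_mul]
  · rw [← intervalIntegral.integral_of_le (by linarith [Real.pi_pos] : -π ≤ π)]
    have hc : (m : ℂ) * I ≠ 0 := mul_ne_zero (Int.cast_ne_zero.2 hm) I_ne_zero
    have h := integral_exp_mul_complex (a := -π) (b := π) hc
    simp_rw [show ∀ x : ℝ, (m : ℂ) * x * I = m * I * x from fun x => by ring]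
    rw [h]
    have h2 : cexp (m * I * (π : ℝ)) = cexp (m * I * ((-π : ℝ) : ℂ)) := by
      rw [show (m : ℂ) * I * (π : ℝ) = m * I * ((-π : ℝ) : ℂ) + m * (2 * π * I) by push_cast; ring, Complex.exp_add,
        Complex.exp_int_mul_two_pi_mul_I, mul_one]
    rw [h2, sub_self, zero_div]

omit [DecidableEq n] in
/-- **Orthogonality on the cube**: `∫_{(−π,π]ⁿ} Π_b e^{i m_b θ_b} dθ = (2π)ⁿ` if `m = 0`, `= 0` otherwise.
[cite: BrockerTomDieck1985, IV (1.11) p0153] -/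
theorem integral_cube_prod_cexp (m : n → ℤ) :
    ∫ θ, ∏ b, cexp (m b * θ b * I) ∂(Measure.pi fun _ : n => (volume : Measure ℝ).restrict (Set.Ioc (-π) π)) =
      if m = 0 then (2 * π : ℂ) ^ Fintype.card n else 0 := by
  rw [integral_fintype_prod_eq_prod (𝕜 := ℂ) (fun b (x : ℝ) => cexp (m b * x * I))]
  simp_rw [integral_Ioc_cexp_int_mul, Fintype.prod_ite_zero, Finset.prod_const, Finset.card_univ]
  congr 1
  simp [funext_iff]

/-! ## §2 The Vandermonde product in characters -/

/-- THE CHARACTER VECTOR of `σ`: `ν_σ(b) = enum(σ⁻¹ b) ∈ ℤ`. [cite: BrockerTomDieck1985, IV (3.2) p0161] -/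
def charVec (σ : Perm n) : n → ℤ := fun b => ((enum n (σ.symm b) : ℕ) : ℤ)

omit [DecidableEq n] in
/-- `ν_σ = ν_τ ⟹ σ = τ`. [cite: BrockerTomDieck1985, IV (3.2) p0161] -/
theorem charVec_injective : Function.Injective (charVec (n := n)) := by
  intro σ τ h
  have hinv : σ.symm = τ.symm := Equiv.ext fun b => by
    have hb := congr_fun h b
    simp only [charVec, Nat.cast_inj] at hb
    exact (enum n).injective (Fin.ext hb)
  simpa using congrArg Equiv.symm hinv

omit [DecidableEq n] in
/-- THE VANDERMONDE PRODUCT `Δ(θ) = Π_{j≺k} (e^{iθ_k} − e^{iθ_j})`. [cite: BrockerTomDieck1985, IV (1.11) p0153] -/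
def vdm (θ : n → ℝ) : ℂ := ∏ p : OD n, (cexp (θ p.1.2 * I) - cexp (θ p.1.1 * I))

/-- THE POWER MATRIX `W(θ)_{ab} = (e^{iθ_a})^{enum b}` (a Vandermonde matrix up to relabelling).
[cite: BrockerTomDieck1985, IV (1.11) p0153] -/
def powMat (θ : n → ℝ) : Matrix n n ℂ := Matrix.of fun a b => cexp (θ a * I) ^ (enum n b : ℕ)

omit [DecidableEq n] in
/-- `W(θ)` is Mathlib's `vandermonde` relabelled by `enum`. [cite: BrockerTomDieck1985, IV (1.11) p0153] -/
theorem powMat_eq_submatrix (θ : n → ℝ) :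
    powMat θ = (Matrix.vandermonde fun i : Fin (Fintype.card n) => cexp (θ ((enum n).symm i) * I)).submatrix
      (enum n) (enum n) := by
  ext a b
  simp [powMat, Matrix.vandermonde_apply]

omit [DecidableEq n] in
/-- Reindexing `Π_{i<j} g(enum⁻¹ i, enum⁻¹ j) = Π_{p : j≺k} g p`. [cite: BrockerTomDieck1985, IV (1.11) p0153] -/
theorem prod_Ioi_eq_prod_OD {α : Type*} [CommMonoid α] (g : n → n → α) :
    ∏ i : Fin (Fintype.card n), ∏ j ∈ Finset.Ioi i, g ((enum n).symm i) ((enum n).symm j) =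
      ∏ p : OD n, g p.1.1 p.1.2 := by
  rw [← Finset.prod_finset_product' ((Finset.univ : Finset (Fin (Fintype.card n) × Fin (Fintype.card n))).filter
    (fun q => q.1 < q.2)) Finset.univ (fun i => Finset.Ioi i)
    (fun q : Fin (Fintype.card n) × Fin (Fintype.card n) => by simp)]
  have h2 : ∏ q ∈ (Finset.univ : Finset (Fin (Fintype.card n) × Fin (Fintype.card n))).filter (fun q => q.1 < q.2),
      g ((enum n).symm q.1) ((enum n).symm q.2) =
      ∏ q ∈ (Finset.univ : Finset (n × n)).filter (fun q => enum n q.1 < enum n q.2), g q.1 q.2 :=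
    Finset.prod_equiv ((enum n).symm.prodCongr (enum n).symm) (fun q => by simp) (fun q _ => rfl)
  rw [h2]
  exact Finset.prod_subtype (p := fun q : n × n => enum n q.1 < enum n q.2)
    ((Finset.univ : Finset (n × n)).filter (fun q => enum n q.1 < enum n q.2))
    (fun q : n × n => by simp) fun q : n × n => g q.1 q.2

/-- **`Δ(θ) = det W(θ)`** (Mathlib's `det_vandermonde`). [cite: BrockerTomDieck1985, IV (1.11) p0153] -/
theorem vdm_eq_det (θ : n → ℝ) : vdm θ = (powMat θ).det := by
  rw [powMat_eq_submatrix, Matrix.det_submatrix_equiv_self, Matrix.det_vandermonde, vdm]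
  exact (prod_Ioi_eq_prod_OD (fun a b => cexp (θ b * I) - cexp (θ a * I))).symm

/-- **LEIBNIZ EXPANSION IN CHARACTERS**: `Δ(θ) = Σ_σ sgn σ · Π_b e^{i ν_σ(b) θ_b}`. [cite: BrockerTomDieck1985, IV (1.11) p0153] -/
theorem vdm_eq_sum (θ : n → ℝ) :
    vdm θ = ∑ σ : Perm n, ((Equiv.Perm.sign σ : ℤ) : ℂ) * ∏ b, cexp (charVec σ b * θ b * I) := by
  rw [vdm_eq_det, Matrix.det_apply']
  refine Finset.sum_congr rfl fun σ _ => ?_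
  congr 1
  calc ∏ a, powMat θ (σ a) a = ∏ a, cexp (((enum n a : ℕ) : ℂ) * (θ (σ a) * I)) := by
        refine Finset.prod_congr rfl fun a _ => ?_
        rw [powMat, Matrix.of_apply, ← Complex.exp_nat_mul]
    _ = ∏ b, cexp (charVec σ b * θ b * I) := by
        rw [← Equiv.prod_comp σ (fun b => cexp (charVec σ b * θ b * I))]
        refine Finset.prod_congr rfl fun a _ => ?_
        simp only [charVec, Equiv.symm_apply_apply, Int.cast_natCast]
        ring_nf

/-- **`|Δ(θ)|² = Σ_{σ,τ} sgn σ sgn τ Π_b e^{i(ν_σ(b) − ν_τ(b))θ_b}`**. [cite: BrockerTomDieck1985, IV (1.11) p0153] -/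
theorem norm_vdm_sq_eq_sum (θ : n → ℝ) :
    ((‖vdm θ‖ ^ 2 : ℝ) : ℂ) = ∑ σ : Perm n, ∑ τ : Perm n,
      ((Equiv.Perm.sign σ : ℤ) : ℂ) * ((Equiv.Perm.sign τ : ℤ) : ℂ) *
        ∏ b, cexp ((charVec σ b - charVec τ b : ℤ) * θ b * I) := by
  rw [← Complex.normSq_eq_norm_sq, ← Complex.mul_conj, vdm_eq_sum, map_sum, Fintype.sum_mul_sum]
  refine Finset.sum_congr rfl fun σ _ => Finset.sum_congr rfl fun τ _ => ?_
  have hconj : ∀ b, conj (cexp (charVec τ b * θ b * I)) = cexp (-(charVec τ b * θ b * I)) := fun b => by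
    rw [← Complex.exp_conj, map_mul, map_mul, map_intCast, Complex.conj_ofReal, Complex.conj_I]
    ring_nf
  rw [map_mul, map_intCast, map_prod]
  simp_rw [hconj]
  rw [mul_mul_mul_comm, ← Finset.prod_mul_distrib]
  congr 1
  refine Finset.prod_congr rfl fun b _ => ?_
  rw [← Complex.exp_add]
  congr 1
  push_cast
  ring

/-! ## §3 The normalising constant -/

/-- Each term of the expansion is integrable on the cube. [cite: BrockerTomDieck1985, IV (1.11) p0153] -/
theorem integrable_cube_term (σ τ : Perm n) :
    Integrable (fun θ : n → ℝ => ((Equiv.Perm.sign σ : ℤ) : ℂ) * ((Equiv.Perm.sign τ : ℤ) : ℂ) *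
        ∏ b, cexp ((charVec σ b - charVec τ b : ℤ) * θ b * I))
      (Measure.pi fun _ : n => (volume : Measure ℝ).restrict (Set.Ioc (-π) π)) := by
  refine Integrable.const_mul ?_ _
  refine Integrable.mono' (integrable_const (1 : ℝ)) ?_ (Filter.Eventually.of_forall fun θ => ?_)
  · exact (continuous_finsetProd _ fun b _ => by fun_prop).aestronglyMeasurable
  · rw [norm_prod]
    refine le_of_eq (Finset.prod_eq_one fun b _ => ?_)
    rw [show ((charVec σ b - charVec τ b : ℤ) : ℂ) * (θ b : ℂ) * I = (((charVec σ b - charVec τ b : ℤ) : ℝ) * θ b : ℝ) * I by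
      push_cast; ring]
    exact Complex.norm_exp_ofReal_mul_I _

/-- **`∫_{(−π,π]ⁿ} |Δ(θ)|² dθ = n! · (2π)ⁿ`** (complex form: only the diagonal `σ = τ` of the double Leibniz sum
survives the orthogonality of characters). [cite: BrockerTomDieck1985, IV (1.11) p0153] [cite: BrockerTomDieck1985, IV (3.2) p0161] -/
theorem integral_cube_norm_vdm_sq :
    ∫ θ, ((‖vdm θ‖ ^ 2 : ℝ) : ℂ) ∂(Measure.pi fun _ : n => (volume : Measure ℝ).restrict (Set.Ioc (-π) π)) =
      (Fintype.card n).factorial * (2 * π : ℂ) ^ Fintype.card n := by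
  simp_rw [norm_vdm_sq_eq_sum]
  rw [integral_finsetSum _ (fun σ _ => integrable_finsetSum _ fun τ _ => integrable_cube_term σ τ)]
  simp_rw [integral_finsetSum _ (fun τ _ => integrable_cube_term _ τ), integral_const_mul]
  have hI : ∀ σ τ : Perm n, ∫ θ, ∏ b, cexp ((charVec σ b - charVec τ b : ℤ) * θ b * I)
      ∂(Measure.pi fun _ : n => (volume : Measure ℝ).restrict (Set.Ioc (-π) π)) =
      if σ = τ then (2 * π : ℂ) ^ Fintype.card n else 0 := by
    intro σ τ
    rw [integral_cube_prod_cexp (n := n) (fun b => charVec σ b - charVec τ b)]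
    congr 1
    simp only [funext_iff, Pi.zero_apply, sub_eq_zero, eq_iff_iff]
    exact ⟨fun h => charVec_injective (funext h), fun h b => by rw [h]⟩
  simp_rw [hI, mul_ite, mul_zero, Finset.sum_ite_eq, Finset.mem_univ, if_true]
  have hsq : ∀ σ : Perm n, ((Equiv.Perm.sign σ : ℤ) : ℂ) * ((Equiv.Perm.sign σ : ℤ) : ℂ) = 1 := fun σ => by
    rw [← Int.cast_mul, ← Units.val_mul, Int.units_mul_self, Units.val_one, Int.cast_one]
  simp_rw [hsq, one_mul, Finset.sum_const, Finset.card_univ, Fintype.card_perm, nsmul_eq_mul]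

omit [DecidableEq n] in
/-- `θ ↦ |Δ(θ)|²` is continuous. [cite: BrockerTomDieck1985, IV (1.11) p0153] -/
theorem continuous_norm_vdm_sq : Continuous fun θ : n → ℝ => ‖vdm θ‖ ^ 2 := by
  unfold vdm
  exact (continuous_finsetProd _ fun p _ => by fun_prop).norm.pow 2

omit [DecidableEq n] in
/-- `|Δ(θ)|² ≤ 4^{#pairs}`. [cite: BrockerTomDieck1985, IV (1.11) p0153] -/
theorem norm_vdm_sq_le (θ : n → ℝ) : ‖vdm θ‖ ^ 2 ≤ (2 ^ Fintype.card (OD n)) ^ 2 := by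
  refine pow_le_pow_left₀ (norm_nonneg _) ?_ 2
  rw [vdm, norm_prod]
  calc ∏ p : OD n, ‖cexp (θ p.1.2 * I) - cexp (θ p.1.1 * I)‖ ≤ ∏ _p : OD n, (2 : ℝ) :=
        Finset.prod_le_prod (fun p _ => norm_nonneg _) fun p _ =>
          (norm_sub_le _ _).trans (by rw [Complex.norm_exp_ofReal_mul_I, Complex.norm_exp_ofReal_mul_I]; norm_num)
    _ = 2 ^ Fintype.card (OD n) := by rw [Finset.prod_const, Finset.card_univ]

/-- **THE NORMALISING CONSTANT OF (1.11) FOR `U(n)`**: `∫_{(−π,π]ⁿ} Π_{j≺k}|e^{iθ_j} − e^{iθ_k}|² dθ = (2π)ⁿ · n!`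
(so that `∫_{Δ(n)} |Δ(t)|² dt = n! = |W|` for the normalised Haar measure, file 6).
[cite: BrockerTomDieck1985, IV (1.11) p0153] [cite: BrockerTomDieck1985, IV (3.2) p0161] -/
theorem lintegral_angleCube_prod_norm_exp_sub_sq :
    ∫⁻ θ in Set.pi Set.univ (fun _ : n => Set.Ioc (-π) π),
        ENNReal.ofReal (∏ p : OD n, ‖cexp (θ p.1.1 * I) - cexp (θ p.1.2 * I)‖ ^ 2) =
      ENNReal.ofReal (2 * π) ^ Fintype.card n * (Fintype.card n).factorial := by
  have hpt : ∀ θ : n → ℝ, ∏ p : OD n, ‖cexp (θ p.1.1 * I) - cexp (θ p.1.2 * I)‖ ^ 2 = ‖vdm θ‖ ^ 2 := fun θ => by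
    rw [vdm, norm_prod, ← Finset.prod_pow]
    exact Finset.prod_congr rfl fun p _ => by rw [norm_sub_rev]
  simp_rw [hpt]
  rw [show (volume : Measure (n → ℝ)).restrict (Set.pi Set.univ fun _ => Set.Ioc (-π) π) =
    Measure.pi fun _ : n => (volume : Measure ℝ).restrict (Set.Ioc (-π) π) from Measure.restrict_pi_pi _ _]
  have hint : Integrable (fun θ : n → ℝ => ‖vdm θ‖ ^ 2)
      (Measure.pi fun _ : n => (volume : Measure ℝ).restrict (Set.Ioc (-π) π)) :=
    Integrable.mono' (integrable_const ((2 ^ Fintype.card (OD n)) ^ 2 : ℝ)) continuous_norm_vdm_sq.aestronglyMeasurable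
      (Filter.Eventually.of_forall fun θ => by rw [Real.norm_of_nonneg (sq_nonneg _)]; exact norm_vdm_sq_le θ)
  rw [← ofReal_integral_eq_lintegral_ofReal hint (Filter.Eventually.of_forall fun θ => sq_nonneg _)]
  have hC := integral_cube_norm_vdm_sq (n := n)
  have hcomm := Complex.ofRealCLM.integral_comp_comm hint
  simp only [Complex.ofRealCLM_apply] at hcomm
  rw [hcomm] at hC
  have hR : ∫ θ, ‖vdm θ‖ ^ 2 ∂(Measure.pi fun _ : n => (volume : Measure ℝ).restrict (Set.Ioc (-π) π)) =
      (Fintype.card n).factorial * (2 * π) ^ Fintype.card n := by exact_mod_cast hC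
  rw [hR, ENNReal.ofReal_mul (by positivity), ENNReal.ofReal_natCast, ENNReal.ofReal_pow (by positivity), mul_comm]

end Literature.RepresentationTheory.CompactGroups.WeylIntegration
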